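import Summits.QuantumFields.YangMills.Theorems.UnitScaleTiltHistoryTailLaneTailChi
import HarnessLib

/-!
# BC3 birth skeleton v5p9 — OWNER PEN ym3-torus-plan g23 (pen base: ym3-torus-p2 g16 draft 546f5342bcd22325; statements byte-identical) = v5p8's THIN RE-CUT with the R-57χ ONE-TOKEN successor stub
# (OWNER RULING g23-№2 ADD. 2/5/6: v5p9 = {2′χ}, no T) over the landed χ-consumer cone — crux `HistoryTailL` (route `UnitScaleTilt`, item stmt-QuantumFields-19936);
# ns `…Cruxes.HistoryTailL.BirthV5p9`

v5p9 (this file): ONE stub {2′χ `stub_laneRecordsV3Chi`} (BYTE-IDENTICAL with v5kC's 2′χ — text `∀ L, Odd L → 1 < L → AlphaInputsT3ACv3RecChi L`) and a two-line composition: the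
whole consumer mathematics of K2-L over a FAMILY OF DATA CORES is in the build — `Theorems/UnitScaleTiltHistoryTail{IntData, IntHistories, IntPint, IntSmallFactor,
DiluteExponentInt (4c), HistoryMassWInt (4a), LowMassCoreInt/LowMassInt (4b at the interior radius), LaneRowsInt (2″/2‴), LaneNumeratorInt, LaneTailInt
(`historyTailL_of_intCoreRec`), LaneTailChi (`historyTailL_of_laneRecordsChi`)}` (seat ym3-torus-p2 g16), on ★alpha-1's `AlphaInputsT3ACv3Core`/`…v3Chi` and the landed
chessboard / v4 tail chain.  So `HistoryTailL_of := historyTailL_of_laneRecordsChi stub_laneRecordsV3Chi`: **19936 is PROVED modulo the χ-lane's END theorem `AlphaInputsT3ACv3RecChi`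
(NODE O's d = 3 (α) record with print's lower row) and nothing else.**  History of the line (v3b → v4 → v5p… → v5p8 → R-57χ): see `Lines/birth_v5p8.lean`'s module docstring.
[cite: Balaban1985UV3, (5) p.256, (41) p.266, (47) p.267, (71) p.273 and Thm 2 p.272; Balaban1985Variational, Thm 1 (8) p.279]
-/

set_option autoImplicit false

namespace Summit.QuantumFields.YangMills.Cruxes.HistoryTailL.BirthV5p9

/-! ## §1 Registered stub (the ONLY sorry) -/

/-- STUB 2′χ (XXL, lane-owned = the END theorem of pub-balaban3d's χ-lineage modulo NODE O; R-57χ: print's lower row (47) «χ·χ_k» on print's validity family `loPrintAC`, the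
core (α) rows at the (40) windows, minimiser rows r1–r3, terminal rows; text = `AlphaInputsT3ACv3Rec`'s with `OfV3At ↦ OfV3ChiAt`, SHARED byte-identically with the
`FluctuationComparisonRegPrIntL` (stmt-QuantumFields-20520) skeleton v5kC) — BAŁABAN'S (α) INPUT ROWS WITH PRINT'S LOWER ROW HOLD FOR THE PINNED CARRIER AT EVERY SUFFICIENTLY
LARGE PROFILE: ★alpha-1's closed Prop `Theorems.AlphaInputsT3ACv3RecChi L` BY NAME. [cite: Balaban1985UV3, Thm 1 p.257, (7) p.257, (47) p.267, (55) p.269 and Thm 2 p.272] -/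
theorem stub_laneRecordsV3Chi : ∀ L : ℕ, Odd L → 1 < L → Summit.QuantumFields.YangMills.Theorems.AlphaInputsT3ACv3RecChi L := by
  sorry

/-! ## §2 The crux BY NAME — no sorry below this line -/

/-- **`HistoryTailL ⇐ stub_laneRecordsV3Chi`**: the landed conditional closer `HistoryTailLaneTailChi.historyTailL_of_laneRecordsChi` applied to STUB 2′χ — the v3′ load-bearing
item stmt-QuantumFields-19936 BY NAME. [cite: Balaban1985UV3, (5) p.256 and (71) p.273; King1986, (3.12) p.657] -/
theorem HistoryTailL_of : Summit.QuantumFields.YangMills.Theses.UnitScaleTilt.HistoryTailL :=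
  Summit.QuantumFields.YangMills.Theorems.HistoryTailLaneTailChi.historyTailL_of_laneRecordsChi stub_laneRecordsV3Chi

end Summit.QuantumFields.YangMills.Cruxes.HistoryTailL.BirthV5p9
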